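import Mathlib
import HarnessLib
import Summits.HubbardSuperconductivity.HubbardSuperconductivity.Theorems.KLProgrammeKLRegimeTwoVolumeLipDoubledBornDiffParts
import Summits.HubbardSuperconductivity.HubbardSuperconductivity.Theorems.KLProgrammeKLRegimeTwoVolumeLipDoubledBlockStepDeep
import Summits.HubbardSuperconductivity.HubbardSuperconductivity.Theorems.KLProgrammeKLRegimeTwoVolumeLipDoubledSourceTransfer
import Summits.HubbardSuperconductivity.HubbardSuperconductivity.Theorems.KLProgrammeKLRegimeTwoVolumeLipBornDiffStepRate
import Summits.HubbardSuperconductivity.HubbardSuperconductivity.Theorems.KLProgrammeKLRegimeTwoVolumeLipDiffSups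

/-!
# Route `KLProgramme` — crux K3 ENGINE (stmt-HubbardSuperconductivity-20437), stub (e) proof-input «(e)-D-ROWS», keying (A′), REKEY-D file D4:
# THE (Db)⁺ ROW OF THE DOUBLED (plain-track) TWO-VOLUME LIPSCHITZ TOWER at a deep pin of either copy, free deep-pin profile, free weight rate
# (seat hubbard-kl-k3c4-p1 g27; doubled twin of ✓ `…TwoVolumeLipBornDiffStepRate.klLipBornDiff_pinned_le_step_of_profile_rate`)

* **`klLipBornDiffD_pinned_le_step_of_profile_rate`** — D4a `sum_pinned_norm_kernel_klLipBornDiffD_le_of_parts` with the LIP part from ✓ D2 `lipBlockStepD_deep_rate_le` (transfer rows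
  from E1's `klScaleWt`-weighted rows via ✓ `one_add_mul_tnorm_le_klScaleWt_pair` / ✓ `transfer_col_le/rowF_le/tauF_le` read on the position-sector component; the plain-pin partner
  fact discharged — same site, `tnorm 0`) and the SRC part from ✓ D3b `lipSourceTransferD_le_of_wtRows`.  Same displayed right-hand side as the sector row (with `Γ′ := SrcLabel (bL) M (dk−1)`);
  extra hypothesis `1 ≤ cW`; `E` is a FREE deep-pin majorant of the doubled input difference (the graded sups of D0 are read only at the END).

Composition of landed theorems; every block constant / profile / row is a hypothesis; nothing asserts the (D) rows, (e), VL, K3 or superconductivity.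
References: BGM 2006 §2.8 (2.76)–(2.90), §3 (3.2)–(3.8) [cite: BenfattoGiulianiMastropietro2006]; Salmhofer 1998 §4.1.
-/

noncomputable section

namespace Summit.HubbardSuperconductivity.HubbardSuperconductivity.Theorems.TwoVolumeLip

set_option linter.dupNamespace false -- summit = problem name (single-conjunct summit), D-0017

open Finset Literature.MathematicalPhysics.QuantumLattice GrassmannAlgebra Literature.Probability.LatticeModels
  Literature.Probability.LatticeModels.BattleFederbush
open Literature.MathematicalPhysics.QuantumLattice.FermiRG
open Summit.HubbardSuperconductivity.HubbardSuperconductivity.Theorems.KLRegimeSplit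
open Summit.HubbardSuperconductivity.HubbardSuperconductivity.Theorems.KLProgrammeLegKernels
open Summit.HubbardSuperconductivity.HubbardSuperconductivity.Theorems.DispersionFlow
open Summit.HubbardSuperconductivity.HubbardSuperconductivity.Theorems.EngineV8
open Summit.HubbardSuperconductivity.HubbardSuperconductivity.Theorems.TwoVolumeSource
open Summit.HubbardSuperconductivity.HubbardSuperconductivity.Theorems.TwoVolumeDefect

/-! ## D4 THE (Db)⁺ ROW at a deep pin of either copy (free profile, free rate) -/

section RowDbD

variable {L b M : ℕ} [NeZero L] [NeZero (b * L)] [NeZero M]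

set_option maxHeartbeats 400000 in -- two large door applications in one declaration
/-- **THE (Db)⁺ ROW of the doubled (plain-track) two-volume Lipschitz tower at a deep pin of EITHER copy, free deep-pin profile `E`, free weight rate `j_w`** — the doubled twin of
✓ `klLipBornDiff_pinned_le_step_of_profile_rate`: D4a `sum_pinned_norm_kernel_klLipBornDiffD_le_of_parts` with the LIP part from ✓ D2 `lipBlockStepD_deep_rate_le` and the SRC part from
✓ D3b `lipSourceTransferD_le_of_wtRows`.  Data: the SECTOR covariance data (`κ`, weighted rows `α` of the fine block covariance) and transfer data (E1's `klScaleWt`-weighted rows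
`cW ≥ 1` of `klLipTransfer (bL)`), the doubled weighted profiles `NV` (glued coarse doubled input), `ND` (doubled input difference), a free deep-pin majorant `E` of the doubled
input difference, the coarse doubled born profiles `N, N_far`, the doubled source-defect profiles `Es, NDs`; output pin `w″` with `w″.1 ∈ klDeepPins L (D₀ + r)`. -/
theorem klLipBornDiffD_pinned_le_step_of_profile_rate {β : ℝ} (hβ : 0 < β) (U μ : ℝ) (K : TrigPolyC4v) {d k jw : ℕ} (hdk : 1 ≤ d * k)
    (hZf : hubbardEffPartitionFnCT (b * L) M β U μ 0 K (klScale klE0 (d * k)) ≠ 0)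
    (hZc : hubbardEffPartitionFnCT L M β U μ 0 K (klScale klE0 (d * k)) ≠ 0)
    {κ : ℝ} (hκ : 0 < κ) (hGB : IsGramBoundedR ((sectorSubMatrix (b * L) M β (bgmFatMultiplier (b * L) M klE0 β (nambuXiCT (b * L) μ K) (d * k - 1))).transpose * hubbardCovSliceCT (b * L) M β μ 0 K (klScale klE0 (d * (k + 1))) (klScale klE0 (d * k)) * sectorSubMatrix (b * L) M β (bgmFatMultiplier (b * L) M klE0 β (nambuXiCT (b * L) μ K) (d * k - 1))) κ)
    (NV ND : ℕ → ℝ) (hNV0 : ∀ m', 0 ≤ NV m') (hND0 : ∀ m', 0 ≤ ND m')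
    (hNV : ∀ m' (j : Fin (2 * m')) (x : SrcLabel (b * L) M (d * k - 1)), ∑ Y ∈ univ.filter (fun Y : Fin (2 * m') → SrcLabel (b * L) M (d * k - 1) => Y j = x),
      ‖kernel ℂ (klGlueD L b M (d * k - 1) (klLipInputD L M β U μ K d k)) (2 * m') Y‖ * klGluedWt L b M β jw (sectorCount (d * k - 1)) ((univ.image Y).image Prod.fst) ≤ NV m')
    (hND : ∀ m' (j : Fin (2 * m')) (x : SrcLabel (b * L) M (d * k - 1)), ∑ Y ∈ univ.filter (fun Y : Fin (2 * m') → SrcLabel (b * L) M (d * k - 1) => Y j = x),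
      ‖kernel ℂ (klLipInputDiffD L b M β U μ K d k) (2 * m') Y‖ * klGluedWt L b M β jw (sectorCount (d * k - 1)) ((univ.image Y).image Prod.fst) ≤ ND m')
    (R R' : ℕ) (E : ℕ → ℝ) (hE0 : ∀ m', 0 ≤ E m')
    (hE : ∀ m' (j : Fin (2 * m')) (x : SrcLabel (b * L) M (d * k - 1)), x ∈ klDeepPinsD (V := b * L) (M := M) (n := d * k - 1) L R →
      ∑ Y ∈ univ.filter (fun Y : Fin (2 * m') → SrcLabel (b * L) M (d * k - 1) => Y j = x), ‖kernel ℂ (klLipInputDiffD L b M β U μ K d k) (2 * m') Y‖ ≤ E m')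
    {α : ℝ} (hα : 0 < α)
    (hrow : ∀ X, ∑ Y, ‖((sectorSubMatrix (b * L) M β (bgmFatMultiplier (b * L) M klE0 β (nambuXiCT (b * L) μ K) (d * k - 1))).transpose * hubbardCovSliceCT (b * L) M β μ 0 K (klScale klE0 (d * (k + 1))) (klScale klE0 (d * k)) * sectorSubMatrix (b * L) M β (bgmFatMultiplier (b * L) M klE0 β (nambuXiCT (b * L) μ K) (d * k - 1))) X Y‖ * klGluedWt L b M β jw (sectorCount (d * k - 1)) {X, Y} ≤ α)
    (hcol : ∀ Y, ∑ X, ‖((sectorSubMatrix (b * L) M β (bgmFatMultiplier (b * L) M klE0 β (nambuXiCT (b * L) μ K) (d * k - 1))).transpose * hubbardCovSliceCT (b * L) M β μ 0 K (klScale klE0 (d * (k + 1))) (klScale klE0 (d * k)) * sectorSubMatrix (b * L) M β (bgmFatMultiplier (b * L) M klE0 β (nambuXiCT (b * L) μ K) (d * k - 1))) X Y‖ * klGluedWt L b M β jw (sectorCount (d * k - 1)) {X, Y} ≤ α)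
    {ρ : ℝ} (hρ : 0 < ρ)
    (hθ₁ : Real.exp 1 * α * normV (SrcLabel (b * L) M (d * k - 1)) κ ρ (fun m' => NV m' + ND m' + E m') / κ ^ 2 < 1)
    (hθ₂ : Real.exp 1 * α * normV (SrcLabel (b * L) M (d * k - 1)) κ ρ (fun m' => NV m' + ND m') / κ ^ 2 < 1)
    {N₀ : ℕ} (hN₀ : 2 ≤ N₀)
    {Λ : ℝ} (hΛ0 : 0 < Λ) (hΛle : Λ ≤ 1 + klScale klE0 jw * ((R' : ℝ) + 1))
    (jr : ℕ) {ΛT cW : ℝ} (hΛT : 0 ≤ ΛT) (hΛr : ΛT ≤ klScale klE0 jr) (hcW1 : 1 ≤ cW)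
    (hrowT : ∀ x, ∑ y', ‖klLipTransfer (b * L) M β μ K d k x y'‖ *
      klScaleWt (b * L) M β jr {latticeLegPos (2 * (2 * M)) x, latticeLegPos (2 * (2 * M)) y'} ≤ cW)
    (hcolT : ∀ y', ∑ x, ‖klLipTransfer (b * L) M β μ K d k x y'‖ *
      klScaleWt (b * L) M β jr {latticeLegPos (2 * (2 * M)) x, latticeLegPos (2 * (2 * M)) y'} ≤ cW)
    (D₀ r : ℕ) (hD₀ : 2 * r ≤ D₀) (hRR' : R + R' ≤ D₀)
    {n q : ℕ} (hq : 2 * q = n + 1)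
    {N Nfar Es NDs : ℝ} (hN0 : 0 ≤ N) (hNfar0 : 0 ≤ Nfar) (hEs0 : 0 ≤ Es) (hNDs0 : 0 ≤ NDs)
    (hN : ∀ (p : Fin (n + 1)) y, ∑ Y ∈ univ.filter (fun Y : Fin (n + 1) → SrcLabel L M (d * k - 1) => Y p = y),
      ‖kernel ℂ (effAction ℂ (klLipCovD L M β μ K d k) (klLipInputD L M β U μ K d k) - klLipInputD L M β U μ K d k) (n + 1) Y‖ ≤ N)
    (hNfar : ∀ (p : Fin (n + 1)) y (i : Fin (n + 1)),
      ∑ Y ∈ univ.filter (fun Y : Fin (n + 1) → SrcLabel L M (d * k - 1) => Y p = y ∧ r < Torus.tnorm ((Y p).1.1.2 - (Y i).1.1.2)),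
        ‖kernel ℂ (effAction ℂ (klLipCovD L M β μ K d k) (klLipInputD L M β U μ K d k) - klLipInputD L M β U μ K d k) (n + 1) Y‖ ≤ Nfar)
    (hEs : ∀ (p : Fin (n + 1)) (y' : SrcLabel (b * L) M (d * k - 1)), y' ∈ klDeepPinsD (V := b * L) (M := M) (n := d * k - 1) L D₀ →
      ∑ Y' ∈ univ.filter (fun Y' : Fin (n + 1) → SrcLabel (b * L) M (d * k - 1) => Y' p = y'),
        ‖kernel ℂ ((effAction ℂ (klLipCovD (b * L) M β μ K d k) (klGlueD L b M (d * k - 1) (klLipInputD L M β U μ K d k)) -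
              klGlueD L b M (d * k - 1) (klLipInputD L M β U μ K d k)) -
            klGlueD L b M (d * k - 1)
              (effAction ℂ (klLipCovD L M β μ K d k) (klLipInputD L M β U μ K d k) - klLipInputD L M β U μ K d k)) (n + 1) Y'‖ ≤ Es)
    (hNDs : ∀ (p : Fin (n + 1)) (y' : SrcLabel (b * L) M (d * k - 1)),
      ∑ Y' ∈ univ.filter (fun Y' : Fin (n + 1) → SrcLabel (b * L) M (d * k - 1) => Y' p = y'),
        ‖kernel ℂ ((effAction ℂ (klLipCovD (b * L) M β μ K d k) (klGlueD L b M (d * k - 1) (klLipInputD L M β U μ K d k)) -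
              klGlueD L b M (d * k - 1) (klLipInputD L M β U μ K d k)) -
            klGlueD L b M (d * k - 1)
              (effAction ℂ (klLipCovD L M β μ K d k) (klLipInputD L M β U μ K d k) - klLipInputD L M β U μ K d k)) (n + 1) Y'‖ ≤ NDs)
    (p : Fin (n + 1)) (w'' : SrcLabel (b * L) M (d * k)) (hw'' : w''.1 ∈ klDeepPins L (D₀ + r)) :
    ∑ X'' ∈ univ.filter (fun X'' : Fin (n + 1) → SrcLabel (b * L) M (d * k) => X'' p = w''),
        ‖kernel ℂ (klLipBornDiffD L b M β U μ K d k) (n + 1) X''‖ ≤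
      cW ^ (2 * q - 1) * (cW *
        ((∑ m' ∈ range (Fintype.card (SrcLabel (b * L) M (d * k - 1)) / 2 + 1), if q < m' then ((2 * m').choose (2 * q) : ℝ) * κ ^ (2 * m' - 2 * q) * E m' else 0) +
          Λ⁻¹ * ∑ m' ∈ range (Fintype.card (SrcLabel (b * L) M (d * k - 1)) / 2 + 1),
            if q < m' then ((2 * m').choose (2 * q) : ℝ) * κ ^ (2 * m' - 2 * q) * ND m' else 0) +
        cW / (1 + ΛT * ((r : ℝ) + 1)) * ∑ m' ∈ range (Fintype.card (SrcLabel (b * L) M (d * k - 1)) / 2 + 1), if q < m' then ((2 * m').choose (2 * q) : ℝ) * κ ^ (2 * m' - 2 * q) * ND m' else 0) +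
      cW ^ (2 * q - 1) * (cW *
        ((∑ n' ∈ Ico 2 N₀, (ρ⁻¹ ^ (2 * q) * κ⁻¹ ^ (2 * (n' - 1)) * (α ^ (n' - 1) * Real.exp n')) *
            ∑ δ ∈ (Fintype.piFinset fun _ : Fin n' => range (Fintype.card (SrcLabel (b * L) M (d * k - 1)) / 2 + 1)) with 2 * q + 2 * (n' - 1) ≤ ∑ a, 2 * δ a,
              ∑ a, (Real.exp 2 * (κ + ρ)) ^ (2 * δ a) * E (δ a) *
                ∏ b' ∈ univ.erase a, (Real.exp 2 * (κ + ρ)) ^ (2 * δ b') * (NV (δ b') + ND (δ b') + E (δ b')) +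
          2 * (ρ⁻¹ ^ (2 * q) * (Real.exp 1 * normV (SrcLabel (b * L) M (d * k - 1)) κ ρ (fun m' => NV m' + ND m' + E m')) *
            (Real.exp 1 * α * normV (SrcLabel (b * L) M (d * k - 1)) κ ρ (fun m' => NV m' + ND m' + E m') / κ ^ 2) ^ (N₀ - 1) /
              (1 - Real.exp 1 * α * normV (SrcLabel (b * L) M (d * k - 1)) κ ρ (fun m' => NV m' + ND m' + E m') / κ ^ 2))) +
        Λ⁻¹ * (∑ n' ∈ Ico 2 N₀, (ρ⁻¹ ^ (2 * q) * κ⁻¹ ^ (2 * (n' - 1)) * (α ^ (n' - 1) * Real.exp n')) *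
            ∑ δ ∈ (Fintype.piFinset fun _ : Fin n' => range (Fintype.card (SrcLabel (b * L) M (d * k - 1)) / 2 + 1)) with 2 * q + 2 * (n' - 1) ≤ ∑ a, 2 * δ a,
              ∑ a, (Real.exp 2 * (κ + ρ)) ^ (2 * δ a) * ND (δ a) *
                ∏ b' ∈ univ.erase a, (Real.exp 2 * (κ + ρ)) ^ (2 * δ b') * (NV (δ b') + ND (δ b')) +
          Λ * (2 * (ρ⁻¹ ^ (2 * q) * (Real.exp 1 * normV (SrcLabel (b * L) M (d * k - 1)) κ ρ (fun m' => NV m' + ND m')) *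
            (Real.exp 1 * α * normV (SrcLabel (b * L) M (d * k - 1)) κ ρ (fun m' => NV m' + ND m') / κ ^ 2) ^ (N₀ - 1) /
              (1 - Real.exp 1 * α * normV (SrcLabel (b * L) M (d * k - 1)) κ ρ (fun m' => NV m' + ND m') / κ ^ 2))))) +
        cW / (1 + ΛT * ((r : ℝ) + 1)) * (∑ n' ∈ Ico 2 N₀, (ρ⁻¹ ^ (2 * q) * κ⁻¹ ^ (2 * (n' - 1)) * (α ^ (n' - 1) * Real.exp n')) *
            ∑ δ ∈ (Fintype.piFinset fun _ : Fin n' => range (Fintype.card (SrcLabel (b * L) M (d * k - 1)) / 2 + 1)) with 2 * q + 2 * (n' - 1) ≤ ∑ a, 2 * δ a,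
              ∑ a, (Real.exp 2 * (κ + ρ)) ^ (2 * δ a) * ND (δ a) *
                ∏ b' ∈ univ.erase a, (Real.exp 2 * (κ + ρ)) ^ (2 * δ b') * (NV (δ b') + ND (δ b')) +
          2 * (ρ⁻¹ ^ (2 * q) * (Real.exp 1 * normV (SrcLabel (b * L) M (d * k - 1)) κ ρ (fun m' => NV m' + ND m')) *
            (Real.exp 1 * α * normV (SrcLabel (b * L) M (d * k - 1)) κ ρ (fun m' => NV m' + ND m') / κ ^ 2) ^ (N₀ - 1) /
              (1 - Real.exp 1 * α * normV (SrcLabel (b * L) M (d * k - 1)) κ ρ (fun m' => NV m' + ND m') / κ ^ 2)))) +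
      (cW ^ n * (cW * Es + cW / (1 + ΛT * ((r : ℝ) + 1)) * NDs) +
        (2 * cW ^ n * (cW / (1 + ΛT * ((r : ℝ) + 1))) * N + n * cW ^ n * (5 * (cW / (1 + ΛT * ((r : ℝ) + 1))) * N + 2 * cW * Nfar))) := by
  have hwd : ∀ j, D₀ + r ≤ (w''.1.1.2 j).val % L ∧ (w''.1.1.2 j).val % L + (D₀ + r) < L := mem_klDeepPins.1 hw''
  have hcW : 0 ≤ cW := le_trans zero_le_one hcW1
  have hrowT' : ∀ x : SpaceTimeIdx (b * L) M × SectorLeg (sectorCount (d * k)),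
      ∑ y', ‖klLipTransfer (b * L) M β μ K d k x y'‖ * (1 + ΛT * (Torus.tnorm (x.1.2 - y'.1.2) : ℝ)) ≤ cW := fun x => by
    refine (sum_le_sum fun y' _ => ?_).trans (hrowT x)
    exact mul_le_mul_of_nonneg_left
      (one_add_mul_tnorm_le_klScaleWt_pair hβ.le hΛr ((x.1, y'.2) : SpaceTimeIdx (b * L) M × SectorLeg (sectorCount (d * k - 1))) y') (norm_nonneg _)
  have hcolT' : ∀ y' : SpaceTimeIdx (b * L) M × SectorLeg (sectorCount (d * k - 1)),
      ∑ x, ‖klLipTransfer (b * L) M β μ K d k x y'‖ * (1 + ΛT * (Torus.tnorm (x.1.2 - y'.1.2) : ℝ)) ≤ cW := fun y' => by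
    refine (sum_le_sum fun x _ => ?_).trans (hcolT y')
    exact mul_le_mul_of_nonneg_left
      (one_add_mul_tnorm_le_klScaleWt_pair hβ.le hΛr ((x.1, y'.2) : SpaceTimeIdx (b * L) M × SectorLeg (sectorCount (d * k - 1))) y') (norm_nonneg _)
  refine sum_pinned_norm_kernel_klLipBornDiffD_le_of_parts hβ.ne' U μ K hdk hZf p w'' ?_ ?_
  · -- LIP: the doubled deep block-step door (D2) with the free profile `E`, near pins `tnorm ≤ r`
    have hcolH := transfer_col_le (fun x : SpaceTimeIdx (b * L) M × SectorLeg (sectorCount (d * k)) => x.1.2)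
      (fun y' : SpaceTimeIdx (b * L) M × SectorLeg (sectorCount (d * k - 1)) => y'.1.2) (klLipTransfer (b * L) M β μ K d k) hΛT hcolT'
    have hrowH := transfer_rowF_le (fun x : SpaceTimeIdx (b * L) M × SectorLeg (sectorCount (d * k)) => x.1.2)
      (fun y' : SpaceTimeIdx (b * L) M × SectorLeg (sectorCount (d * k - 1)) => y'.1.2) (klLipTransfer (b * L) M β μ K d k) hΛT hrowT' r w''.1
    have hτH := transfer_tauF_le (fun x : SpaceTimeIdx (b * L) M × SectorLeg (sectorCount (d * k)) => x.1.2)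
      (fun y' : SpaceTimeIdx (b * L) M × SectorLeg (sectorCount (d * k - 1)) => y'.1.2) (klLipTransfer (b * L) M β μ K d k) hΛT hrowT' hcW (le_refl r) w''.1
    have hW : w''.2 = 1 → ∀ y, klPlainShift (b * L) M (sectorCount (d * k)) (sectorCount (d * k - 1)) w''.1 y ≠ 0 →
        Torus.tnorm (w''.1.1.2 - y.1.2) ≤ r := by
      intro _ y hne
      rw [klPlainShift_ne_zero_site hne, sub_self]
      have h0 : Torus.tnorm (0 : TorusSite 2 (b * L)) = 0 := by
        have h : Torus.tnorm (0 : TorusSite 2 (b * L)) ≤ Site.supNorm (0 : Site 2) := by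
          have h1 := Torus.tnorm_proj_le (L := b * L) (0 : Site 2)
          have h00 : Torus.proj (b * L) (0 : Site 2) = 0 := by funext i; simp [Torus.proj_apply]
          rwa [h00] at h1
        have h2 : Site.supNorm (0 : Site 2) = 0 := Nat.le_zero.1 (Site.supNorm_le_iff.2 fun i => by simp)
        exact Nat.le_zero.1 (h2 ▸ h)
      rw [h0]; exact Nat.zero_le _
    refine le_of_eq_of_le (sum_pinned_norm_kernel_congr_deg _ hq p w'').symm ?_
    exact lipBlockStepD_deep_rate_le hβ U μ K hZf hZc hκ hGB NV ND E hNV0 hND0 hE0 hNV hND R R' hE hα hrow hcol hρ hθ₁ hθ₂ hN₀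
      (fun y' => Torus.tnorm (w''.1.1.2 - y'.1.2) ≤ r) (fun y' hy' => klDeepPins_mono hRR' (mem_klDeepPins_of_tnorm_le hwd hy')) hcW1
      (div_nonneg hcW (by positivity)) hcolH w'' hrowH hτH hW hΛ0 hΛle (Fin.cast hq.symm p)
  · -- SRC: the doubled transfer door (D3b), rows discharged; `Es` read at the `D₀`-deep near pins
    exact lipSourceTransferD_le_of_wtRows hβ U μ K hdk hZc hΛT hcW1 hrowT' hcolT' p w'' D₀ r hD₀ hwd hN0 hNfar0 hEs0 hNDs0 (hN p) (hNfar p)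
      (fun y' hy' => hEs p y' (mem_klDeepPinsD.2 (mem_klDeepPins_of_tnorm_le hwd hy'))) (hNDs p)

end RowDbD

end Summit.HubbardSuperconductivity.HubbardSuperconductivity.Theorems.TwoVolumeLip

end
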